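import Literature.NumberTheory.GaloisCohomology.KolyvaginSystems
import Literature.NumberTheory.EllipticCurves.GeomPointsGaloisModule
import HarnessLib

/-!
# Transport lemmas for the DEEP Chebotarev sub-class of Kolyvagin primes (S24-DEEP, n1011 ROUTE-1
# R1-35): `𝒫′ ⊆ 𝒫`, and the torsion-tower kernel / ramification inclusions that feed its binders on
# N11 rows (cell `b2b-bsdres`, team n1011; CLASS-CLOSURE typer of record N11 = seat cc-typer-1,
# gen 8; typer duty (c) "transport lemmas"; sibling of `GaloisImage/KolyvaginDeepSubclass.lean`)

HONEST FRAMING (cell `b2b-bsdres`, run/shared/lean/b2b/bsd-rank1-residual/, verbatim in every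
file): the goal of the cell is to DELETE the COMBINATION-SHAPED residual classes of the
Birch–Swinnerton-Dyer formula for ALL analytic-rank `≤ 1` elliptic curves over `ℚ` — "full BSD
formula for every rank `≤ 1` curve in class `C`" assembled STRICTLY from published theorems — so
that the rank-`≤ 1` remainder becomes exactly the CONSTRUCTION-SHAPED classes, which are TYPED
(missing-input `Prop`s), NOT attempted. This is not "finishing BSD". Team n1011 (N10 / N11, the
additive block X4 ∧ `p = 3`): research route on the CONSTRUCTION-SHAPED class X4; no claim beyond the
stated classes; nothing is booked; no label and no RESIDUAL-MAP mark is moved by this file.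
THEOREMS ONLY (no definition, no named fact, no `sorry`); elementary.

## Contents

The typed input S24-DEEP (`GaloisImage/KolyvaginDeepSubclass.lean`, ns `…GaloisImage.S24Deep`)
replaces Sakamoto's pinned prime set `𝒫 = frobeniusClassPrimes ρ S τ (3^m)` by the sub-class
`𝒫′ = frobeniusClassPrimes ρ′ S τ (3^{m′})` cut out through a deeper module `T′` (`ker ρ′ ≤ ker ρ`,
`m ≤ m′`). This file records, once, the inclusions consumers need:

* `frobeniusClassPrimes_mono` — **`𝒫′ ⊆ 𝒫`**: for discrete Galois modules `ρ, ρ′` over a number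
  field with `∀ u, ρ′ u = 1 → ρ u = 1` and levels `N ∣ N′`,
  `frobeniusClassPrimes ρ′ S τ N′ ⊆ frobeniusClassPrimes ρ S τ N` (so every per-prime lemma stated on
  `𝒫` applies on `𝒫′`; Sakamoto's restrictive uses of `𝒫`, JTNB 36 (2024) p. 925, are inherited).
* `isUnramifiedAt_of_ker_le` — `ρ′` unramified at `v` ⟹ `ρ` unramified at `v` under the same kernel
  inclusion.
* Torsion tower of an elliptic curve `E/F` (`geomTorsion W n = E[n] ≤ E(F̄)`): for `n ∣ n′`,
  `smul_eq_self_torsion_of_dvd` (an automorphism fixing `E[n′]` pointwise fixes `E[n]`),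
  **`torsionGaloisModule_eq_one_of_dvd`** (`ρ_{E,n′} u = 1 → ρ_{E,n} u = 1` — the (Δ1) binder
  `∀ u, ρ′ u = 1 → ρ u = 1` of S24-DEEP for `T = E[n]`, `T′ = E[n′]`),
  `isUnramifiedAt_torsionGaloisModule_of_dvd`, and the N11 spellings
  `torsionGaloisModule_pow_mul_eq_one_of_le` / `frobeniusClassPrimes_torsion_pow_mul_mono`
  (levels `((p : ℕ) : ℤ) ^ k * p`, `k ≤ k′`, as in `SakamotoN11Instance*.lean`).

References: R. Sakamoto, *The theory of Kolyvagin systems for `p = 3`*, JTNB **36** (2024) §2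
(p. 921, the set `𝒫`), §4 (p. 925); J. Silverman, *AEC*, III.§7. [folklore]
-/

noncomputable section

open scoped Classical NumberField ContRepresentation
open Field NumberField IsDedekindDomain
open Literature.NumberTheory.GaloisRepresentations Literature.NumberTheory.GaloisCohomology

namespace Summit.BirchSwinnertonDyer.Rank1Residual.GaloisImage.S24Deep

universe u

/-! ### Generic: kernel inclusion ⟹ `𝒫′ ⊆ 𝒫` and ramification transport -/

section Generic

variable {K : Type u} [Field K] [NumberField K]
variable {M : Type u} [AddCommGroup M] [TopologicalSpace M] [DiscreteTopology M]
variable {M' : Type u} [AddCommGroup M'] [TopologicalSpace M'] [DiscreteTopology M']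

omit [NumberField K] in
/-- Ramification transport along a kernel inclusion: if every `u` acting trivially on `T′` acts
trivially on `T` (`ker ρ′ ≤ ker ρ`, e.g. `T` a subquotient of `T′`), then `ρ′` unramified at `v`
implies `ρ` unramified at `v`. Serre, *Abelian ℓ-adic representations*, I.§2.1. [folklore] -/
theorem isUnramifiedAt_of_ker_le (ρ : DiscreteGaloisModule K M) (ρ' : DiscreteGaloisModule K M')
    (hker : ∀ u : absoluteGaloisGroup K, ρ' u = 1 → ρ u = 1) (v : HeightOneSpectrum (𝓞 K))
    (hv : GaloisRep.IsUnramifiedAt v ρ') : GaloisRep.IsUnramifiedAt v ρ :=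
  fun 𝔓 h𝔓 σ hσ => hker σ (hv 𝔓 h𝔓 σ hσ)

/-- **`𝒫′ ⊆ 𝒫`.** Sakamoto's Frobenius-class primes are antitone in the pair (module, level): for
`ker ρ′ ≤ ker ρ` and `N ∣ N′`, a prime `v ∉ S`, `v ∤ N′`, unramified for `T′`, whose Frobenius is
conjugate to `τ` in `Gal(K(μ_{N′}, T′)/K)` is a prime `v ∤ N`, unramified for `T`, whose Frobenius is
conjugate to `τ` in `Gal(K(μ_N, T)/K)`. (The DEEP sub-class of S24-DEEP lies inside the pinned class
of the landed facts, so Sakamoto's "for any prime `𝔮 ∈ 𝒫`" statements, JTNB 36 (2024) p. 925, are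
inherited by it.) [folklore] -/
theorem frobeniusClassPrimes_mono (ρ : DiscreteGaloisModule K M) (ρ' : DiscreteGaloisModule K M')
    (hker : ∀ u : absoluteGaloisGroup K, ρ' u = 1 → ρ u = 1)
    (S : Set (HeightOneSpectrum (𝓞 K))) (τ : absoluteGaloisGroup K) {N N' : ℕ} (hN : N ∣ N') :
    frobeniusClassPrimes ρ' S τ N' ⊆ frobeniusClassPrimes ρ S τ N := by
  rintro v ⟨hvS, hvN, hur, σ, hσ, hfix, hζ⟩
  obtain ⟨c, rfl⟩ := hN
  refine ⟨hvS, ?_, isUnramifiedAt_of_ker_le ρ ρ' hker v hur, σ, hσ, ?_, ?_⟩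
  · intro h
    apply hvN
    have : (((N * c : ℕ) : 𝓞 K)) = ((N : ℕ) : 𝓞 K) * ((c : ℕ) : 𝓞 K) := by push_cast; ring
    rw [this]
    exact v.asIdeal.mul_mem_right _ h
  · have h1 : ρ' (σ * τ⁻¹) = 1 := LinearMap.ext fun m => by simpa using hfix m
    intro m
    have h2 := hker _ h1
    simpa using LinearMap.congr_fun h2 m
  · intro ζ hζN
    exact hζ ζ (by rw [pow_mul, hζN, one_pow])

end Generic

/-! ### The torsion tower of an elliptic curve -/

section Torsion

open WeierstrassCurve Literature.NumberTheory.EllipticCurves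

variable {F : Type} [Field F] (W : WeierstrassCurve F)

/-- An automorphism fixing `E[n′]` pointwise fixes `E[n] ⊆ E[n′]` pointwise (`n ∣ n′`).
Silverman, *AEC*, III.§7. [folklore] -/
theorem smul_eq_self_torsion_of_dvd {n n' : ℤ} (h : n ∣ n') (z : absoluteGaloisGroup F)
    (hz : ∀ P : geomTorsion W n', z • P = P) (x : geomTorsion W n) : z • x = x := by
  -- `E[n] ≤ E[n′]` is Mathlib's `Submodule.torsionBy_le_torsionBy_of_dvd` (tree alias
  -- `WeierstrassCurve.geomTorsion_le_of_dvd` in `SelmerTorsionInclusion.lean`, not imported here).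
  have hx : (x : geomPoints W) ∈ geomTorsion W n' := Submodule.torsionBy_le_torsionBy_of_dvd n n' h x.2
  have h1 := congrArg Subtype.val (hz ⟨x, hx⟩)
  rw [AddSubgroup.torsionBy.coe_smul] at h1
  apply Subtype.ext
  rw [AddSubgroup.torsionBy.coe_smul]
  exact h1

/-- **Kernel inclusion down the torsion tower** — the (Δ1) binder `∀ u, ρ′ u = 1 → ρ u = 1` of
S24-DEEP for `T = E[n]`, `T′ = E[n′]`, `n ∣ n′`: `ρ_{E,n′}(u) = 1 ⟹ ρ_{E,n}(u) = 1`
(`ℚ(E[n]) ⊆ ℚ(E[n′])`). Silverman, *AEC*, III.§7. [folklore] -/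
theorem torsionGaloisModule_eq_one_of_dvd {n n' : ℤ} (h : n ∣ n') (u : absoluteGaloisGroup F)
    (hu : W.torsionGaloisModule n' u = 1) : W.torsionGaloisModule n u = 1 := by
  refine LinearMap.ext fun x => ?_
  rw [torsionGaloisModule_apply_apply]
  exact smul_eq_self_torsion_of_dvd W h u (fun P => by
    rw [← torsionGaloisModule_apply_apply, hu]; rfl) x

/-- Ramification down the torsion tower: `E[n′]` unramified at `v` ⟹ `E[n]` unramified at `v`
(`n ∣ n′`). Silverman, *AEC*, VII.§4. [folklore] -/
theorem isUnramifiedAt_torsionGaloisModule_of_dvd {F : Type} [Field F] [NumberField F]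
    (W : WeierstrassCurve F) {n n' : ℤ} (h : n ∣ n') (v : HeightOneSpectrum (𝓞 F))
    (hv : GaloisRep.IsUnramifiedAt v (W.torsionGaloisModule n')) :
    GaloisRep.IsUnramifiedAt v (W.torsionGaloisModule n) :=
  isUnramifiedAt_of_ker_le (W.torsionGaloisModule n) (W.torsionGaloisModule n')
    (fun u hu => torsionGaloisModule_eq_one_of_dvd W h u hu) v hv

/-- The N11 spelling (levels `p^k · p` as in `SakamotoN11Instance*.lean`): for `k ≤ k′`,
`ρ_{E,p^{k′+1}}(u) = 1 ⟹ ρ_{E,p^{k+1}}(u) = 1`. [folklore] -/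
theorem torsionGaloisModule_pow_mul_eq_one_of_le (p : ℤ) {k k' : ℕ} (hk : k ≤ k')
    (u : absoluteGaloisGroup F) (hu : W.torsionGaloisModule (p ^ k' * p) u = 1) :
    W.torsionGaloisModule (p ^ k * p) u = 1 :=
  torsionGaloisModule_eq_one_of_dvd W (mul_dvd_mul_right (pow_dvd_pow p hk) p) u hu

/-- The N11 spelling of `𝒫′ ⊆ 𝒫` for an elliptic curve over a number field: for `k ≤ k′` and levels
`N ∣ N′`, the Frobenius-class primes of `E[p^{k′+1}]` at level `N′` lie inside those of `E[p^{k+1}]`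
at level `N` (same `S`, same `τ`). [folklore] -/
theorem frobeniusClassPrimes_torsion_pow_mul_mono {F : Type} [Field F] [NumberField F]
    (W : WeierstrassCurve F) (p : ℤ) {k k' : ℕ} (hk : k ≤ k')
    (S : Set (HeightOneSpectrum (𝓞 F))) (τ : absoluteGaloisGroup F) {N N' : ℕ} (hN : N ∣ N') :
    frobeniusClassPrimes (W.torsionGaloisModule (p ^ k' * p)) S τ N' ⊆
      frobeniusClassPrimes (W.torsionGaloisModule (p ^ k * p)) S τ N :=
  frobeniusClassPrimes_mono _ _ (fun u hu => torsionGaloisModule_pow_mul_eq_one_of_le W p hk u hu)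
    S τ hN

end Torsion

end Summit.BirchSwinnertonDyer.Rank1Residual.GaloisImage.S24Deep

end
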